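import Mathlib.RingTheory.MvPolynomial.Homogeneous
import Literature.NumberTheory.Transcendental.ExpDominantSolvabilityAnalysis
import Summits.Schanuel.Schanuel.Theorems.ZilberEacComplexMovingPolydisc
import HarnessLib

/-!
# Exponential points over graph bases with super-logarithmic decay of the coupling

Second file of the "oscillatory base" sub-rung of Zilber's Exponential-Algebraic Closedness for
`ℂ_exp` in the range `dim π₁(V) = n - 1` (first open rung: Mantova–Masser, PLMS 129 (2024), §1
p. 5). For the `(s+1)`-folds
`V = {x_{s+1} = g(x'), y_j = A_j(x') + y_{s+1} F_j(y_{s+1}, x') (j ≤ s)} ⊆ ℂ^{s+1} × (ℂˣ)^{s+1}`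
(additive projection = the graph hypersurface `x_{s+1} = g`), an exponential point is a solution
`x ∈ ℂˢ` of `exp xⱼ = Aⱼ(x) + e^{g(x)} Fⱼ(e^{g(x)}, x)`.

* `latticeValue_eventually` — eventual two-sided logarithmic control of `Aⱼ(2πi m q)`;
* `exists_expPoint_of_superlog_decay` — **abstract decay theorem**: if on the unit polydiscs
  around the lattice centres `x₀(m)` one has `Re g ≤ -N log m` for every `N` and all large `m`,
  the system is solvable near `x₀(m)` for all large `m` (from the moving-polydisc perturbation
  theorem `exists_exp_eq_poly_add_near_latticeCentre`);
* `exists_expPoint_of_re_leadingForm_neg` — the decay hypothesis holds when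
  `Re g_D(2πi q) < 0` (leading order; this recovers and extends
  `exists_expPoint_punctureDecoupling` from affine decoupled `Aⱼ(xⱼ)` to arbitrary polynomials
  `Aⱼ(x')` with `(Aⱼ)_{dⱼ}(2πi q) ≠ 0`, with explicit localisation).

The genuinely new case `Re g_D(2πi q) = 0` (second-order asymptotics) is in
`ZilberEacComplexSecondOrder.lean`.

HONEST FRAMING: modest new sub-rung of EAC; nothing here bears on Schanuel's conjecture.
-/

noncomputable section

open Complex MvPolynomial Metric Set Filter Topology

set_option linter.dupNamespace false

namespace Summit.Schanuel.Schanuel.Theorems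

/-! ### Eventual control of the lattice values -/

/-- **Eventual logarithmic control of the lattice values.** If the leading form `A_d` of
`A ∈ ℂ[x₁..xₛ]` does not vanish at `v`, then for all large `m ∈ ℕ`: `A(m v) ≠ 0`,
`d log m + log(‖A_d(v)‖/2) ≤ log ‖A(m v)‖ ≤ d log m + log(2‖A_d(v)‖)`, and
`‖log A(m v)‖ ≤ d log m + (|log(‖A_d(v)‖/2)| + |log(2‖A_d(v)‖)| + π)`. [folklore] -/
theorem latticeValue_eventually {s : ℕ} (A : MvPolynomial (Fin s) ℂ) (v : Fin s → ℂ)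
    (hA : eval v (homogeneousComponent A.totalDegree A) ≠ 0) :
    ∀ᶠ m : ℕ in atTop, eval (fun i => (m : ℂ) * v i) A ≠ 0 ∧
      (A.totalDegree * Real.log m +
          Real.log (‖eval v (homogeneousComponent A.totalDegree A)‖ / 2) ≤
        Real.log ‖eval (fun i => (m : ℂ) * v i) A‖ ∧
      Real.log ‖eval (fun i => (m : ℂ) * v i) A‖ ≤
        A.totalDegree * Real.log m +
          Real.log (2 * ‖eval v (homogeneousComponent A.totalDegree A)‖)) ∧
      ‖log (eval (fun i => (m : ℂ) * v i) A)‖ ≤ A.totalDegree * Real.log m +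
        (|Real.log (‖eval v (homogeneousComponent A.totalDegree A)‖ / 2)| +
          |Real.log (2 * ‖eval v (homogeneousComponent A.totalDegree A)‖)| + Real.pi) := by
  obtain ⟨ρ, -, t₀, ht₀, hc⟩ := latticeValue_control A v hA one_pos
  have ha0 : 0 < ‖eval v (homogeneousComponent A.totalDegree A)‖ := norm_pos_iff.mpr hA
  filter_upwards [tendsto_natCast_atTop_atTop.eventually_ge_atTop t₀] with m hm
  obtain ⟨hne, hlow, hupp, -⟩ := hc m hm
  have hm1 : (1 : ℝ) ≤ m := ht₀.trans hm
  obtain ⟨h1, h2, h3⟩ := log_latticeValue_bounds (by positivity) hm1 hlow hupp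
  exact ⟨hne, ⟨h1, h2⟩, h3⟩

/-- For every `δ > 0`, eventually `‖(log Aⱼ(m v))ⱼ‖ + 1 ≤ δ m` (all leading forms non-vanishing
at `v`). [folklore] -/
theorem eventually_norm_log_latticeValue_le {s : ℕ} (A : Fin s → MvPolynomial (Fin s) ℂ)
    (v : Fin s → ℂ) (hA : ∀ j, eval v (homogeneousComponent (A j).totalDegree (A j)) ≠ 0)
    {δ : ℝ} (hδ : 0 < δ) :
    ∀ᶠ m : ℕ in atTop, ‖fun j => log (eval (fun i => (m : ℂ) * v i) (A j))‖ + 1 ≤ δ * m := by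
  have h1 : ∀ᶠ m : ℕ in atTop, ∀ j,
      ‖log (eval (fun i => (m : ℂ) * v i) (A j))‖ ≤ δ / 2 * m := by
    refine eventually_all.2 fun j => ?_
    filter_upwards [latticeValue_eventually (A j) v (hA j),
      eventually_mul_log_add_le ((A j).totalDegree : ℝ)
        (|Real.log (‖eval v (homogeneousComponent (A j).totalDegree (A j))‖ / 2)| +
          |Real.log (2 * ‖eval v (homogeneousComponent (A j).totalDegree (A j))‖)| + Real.pi)
        (half_pos hδ)] with m hm hm'
    exact hm.2.2.trans hm'
  filter_upwards [h1, (tendsto_natCast_atTop_atTop.const_mul_atTop (half_pos hδ)).eventually_ge_atTop 1]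
    with m hm hm'
  have : ‖fun j => log (eval (fun i => (m : ℂ) * v i) (A j))‖ ≤ δ / 2 * m :=
    (pi_norm_le_iff_of_nonneg (by positivity)).2 fun j => hm j
  linarith

/-! ### The abstract decay theorem -/

/-- **Exponential points under super-logarithmic decay of the coupling.** Let `q ∈ ℤˢ`,
`v = 2πi q`, `g ∈ ℂ[x₁..xₛ]`, `Aⱼ ∈ ℂ[x₁..xₛ]` with `(Aⱼ)_{dⱼ}(v) ≠ 0`, `Fⱼ ∈ ℂ[u, x₁..xₛ]`
(`j ≤ s`), and let `x₀(m) = (m vⱼ + log Aⱼ(m v))ⱼ` be the lattice centres. Assume the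
**decay hypothesis**: for every `N ∈ ℕ`, for all large `m` and all `‖ξ‖ ≤ 1`,
`Re g(x₀(m) + ξ) ≤ -N log m`. Then for all large `m` the system
`exp xⱼ = Aⱼ(x) + e^{g(x)} Fⱼ(e^{g(x)}, x)` (`j ≤ s`) has a solution with `‖x - x₀(m)‖ ≤ 1/2`;
i.e. the `(s+1)`-fold `V = {x_{s+1} = g(x'), yⱼ = Aⱼ(x') + y_{s+1} Fⱼ(y_{s+1}, x')}`, whose
additive projection is the graph hypersurface `x_{s+1} = g` (`dim π₁ V = n - 1`, the first open
range of Exponential-Algebraic Closedness, Mantova–Masser 2024 §1 p. 5), has exponential points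
over every such lattice direction. Proof: `|e^{g}| ≤ m^{-N}` beats the polynomial growth of
`Fⱼ(e^{g}, x)` on the polydisc (`‖x‖ = O(m)`), so the moving-polydisc perturbation theorem
applies. New. [cite: MantovaMasser2023, §1 p.5 (the open case dim π(V) = 2 in ℂ³×ℂˣ³)] -/
theorem exists_expPoint_of_superlog_decay {s : ℕ} (g : MvPolynomial (Fin s) ℂ) (q : Fin s → ℤ)
    (A : Fin s → MvPolynomial (Fin s) ℂ)
    (hA : ∀ j, eval (fun i => 2 * Real.pi * I * (q i : ℂ))
      (homogeneousComponent (A j).totalDegree (A j)) ≠ 0)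
    (F : Fin s → MvPolynomial (Fin (s + 1)) ℂ)
    (hdecay : ∀ N : ℕ, ∀ᶠ m : ℕ in atTop, ∀ ξ : Fin s → ℂ, ‖ξ‖ ≤ 1 →
      (eval ((fun i => (m : ℂ) * (2 * Real.pi * I * (q i : ℂ)) +
          log (eval (fun k => (m : ℂ) * (2 * Real.pi * I * (q k : ℂ))) (A i))) + ξ) g).re ≤
        -(N * Real.log m)) :
    ∀ᶠ m : ℕ in atTop, ∃ x : Fin s → ℂ,
      ‖x - fun i => (m : ℂ) * (2 * Real.pi * I * (q i : ℂ)) +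
          log (eval (fun k => (m : ℂ) * (2 * Real.pi * I * (q k : ℂ))) (A i))‖ ≤ 1 / 2 ∧
      ∀ j, exp (x j) = eval x (A j) +
        exp (eval x g) * eval (Fin.cons (exp (eval x g)) x) (F j) := by
  classical
  set v : Fin s → ℂ := fun j => 2 * Real.pi * I * (q j : ℂ) with hv
  set x₀ : ℕ → Fin s → ℂ := fun m i => (m : ℂ) * v i +
    log (eval (fun k => (m : ℂ) * v k) (A i)) with hx₀
  set P : Fin s → (Fin s → ℂ) → ℂ := fun j x =>
    exp (eval x g) * eval (Fin.cons (exp (eval x g)) x) (F j) with hP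
  have hPdiff : ∀ j, Differentiable ℂ (P j) := by
    intro j
    have h1 : Differentiable ℂ fun x : Fin s → ℂ => exp (eval x g) :=
      (differentiable_mvPolynomial_eval g).cexp
    exact h1.mul ((differentiable_mvPolynomial_eval (F j)).comp (differentiable_finCons h1))
  -- size of the lattice centres: `‖x₀ m‖ + 1 ≤ K m`
  set K : ℝ := ‖v‖ + 1 with hK
  have hK1 : 1 ≤ K := by have := norm_nonneg v; linarith
  have hx₀K : ∀ᶠ m : ℕ in atTop, ‖x₀ m‖ + 1 ≤ K * m := by
    filter_upwards [eventually_norm_log_latticeValue_le A v hA one_pos] with m hm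
    have h1 : x₀ m = (fun i => (m : ℂ) * v i) + fun i => log (eval (fun k => (m : ℂ) * v k) (A i)) := by
      funext i; simp only [hx₀, Pi.add_apply]
    have h2 : ‖(fun i => (m : ℂ) * v i)‖ ≤ ‖v‖ * m := by
      have : (fun i => (m : ℂ) * v i) = (m : ℂ) • v := by
        funext i; simp [Pi.smul_apply, smul_eq_mul]
      rw [this, norm_smul, Complex.norm_natCast, mul_comm]
    rw [h1]
    calc ‖(fun i => (m : ℂ) * v i) + fun i => log (eval (fun k => (m : ℂ) * v k) (A i))‖ + 1
        ≤ ‖v‖ * m + (‖fun i => log (eval (fun k => (m : ℂ) * v k) (A i))‖ + 1) := by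
          have := norm_add_le (fun i => (m : ℂ) * v i)
            (fun i => log (eval (fun k => (m : ℂ) * v k) (A i)))
          linarith
      _ ≤ ‖v‖ * m + 1 * m := by linarith
      _ = K * m := by rw [hK]; ring
  -- smallness of the perturbations on the moving polydiscs
  have hPsmall : ∀ j, ∀ θ : ℝ, 0 < θ → ∀ᶠ m : ℕ in atTop, ∀ ξ : Fin s → ℂ, ‖ξ‖ ≤ 1 →
      ‖P j (x₀ m + ξ)‖ ≤ θ := by
    intro j θ hθ
    obtain ⟨C, hC, N, hCN⟩ :=
      Literature.NumberTheory.Transcendental.HypersurfaceCover.exists_norm_eval_le_pow (F j)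
    have hev : ∀ᶠ m : ℕ in atTop, C * (2 + K) ^ N ≤ θ * m :=
      (tendsto_natCast_atTop_atTop.const_mul_atTop hθ).eventually_ge_atTop _
    filter_upwards [hdecay (N + 1), hx₀K, hev, eventually_ge_atTop 1] with m hmd hmK hmθ hm1
    intro ξ hξ
    have hm1' : (1 : ℝ) ≤ m := by exact_mod_cast hm1
    have hm0 : (0 : ℝ) < m := by linarith
    set x := x₀ m + ξ with hx
    have hre : (eval x g).re ≤ -((N + 1 : ℕ) * Real.log m) := hmd ξ hξ
    have hlog0 : 0 ≤ Real.log m := Real.log_nonneg hm1'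
    -- `|e^{g(x)}| ≤ m^{-(N+1)}` and `≤ 1`
    have hexp_le : ‖exp (eval x g)‖ ≤ ((m : ℝ) ^ (N + 1))⁻¹ := by
      rw [Complex.norm_exp]
      refine (Real.exp_le_exp.mpr hre).trans ?_
      rw [Real.exp_neg, Real.exp_nat_mul, Real.exp_log hm0]
    have hexp_le1 : ‖exp (eval x g)‖ ≤ 1 := by
      rw [Complex.norm_exp]
      refine Real.exp_le_one_iff.mpr (hre.trans ?_)
      have : (0 : ℝ) ≤ (N + 1 : ℕ) * Real.log m := by positivity
      linarith
    -- size of `x` and of `(e^{g(x)}, x)`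
    have hxn : ‖x‖ ≤ K * m := by
      calc ‖x‖ ≤ ‖x₀ m‖ + ‖ξ‖ := norm_add_le _ _
        _ ≤ ‖x₀ m‖ + 1 := by linarith
        _ ≤ K * m := hmK
    have hcons : ‖(Fin.cons (exp (eval x g)) x : Fin (s + 1) → ℂ)‖ ≤ 1 + K * m :=
      norm_finCons_le hexp_le1 (by positivity) hxn
    have hFb : ‖eval (Fin.cons (exp (eval x g)) x) (F j)‖ ≤ C * ((2 + K) * m) ^ N := by
      refine (hCN _).trans (mul_le_mul_of_nonneg_left ?_ hC)
      refine pow_le_pow_left₀ (by positivity) ?_ _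
      nlinarith
    calc ‖P j x‖ = ‖exp (eval x g)‖ * ‖eval (Fin.cons (exp (eval x g)) x) (F j)‖ := norm_mul _ _
      _ ≤ ((m : ℝ) ^ (N + 1))⁻¹ * (C * ((2 + K) * m) ^ N) :=
          mul_le_mul hexp_le hFb (norm_nonneg _) (by positivity)
      _ = C * (2 + K) ^ N / m := by
          rw [mul_pow, pow_succ]
          field_simp
      _ ≤ θ := by rw [div_le_iff₀ hm0]; exact hmθ
  exact exists_exp_eq_poly_add_near_latticeCentre q A hA P hPdiff hPsmall

/-! ### Leading order: negative real part of the leading form -/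

/-- **Negative leading real part ⇒ decay ⇒ exponential points.** If `deg g = D ≥ 1` and
`Re g_D(2πi q) < 0`, then on the unit polydiscs around the lattice centres `Re g ≤ -(c/2) m^D`,
so `exists_expPoint_of_superlog_decay` applies: for all large `m` the system
`exp xⱼ = Aⱼ(x) + e^{g(x)} Fⱼ(e^{g(x)}, x)` has a solution with `‖x - x₀(m)‖ ≤ 1/2`. This extends
`exists_expPoint_punctureDecoupling` (affine decoupled `Aⱼ(xⱼ) = aⱼ xⱼ + bⱼ`) to arbitrary
`Aⱼ ∈ ℂ[x₁..xₛ]` with `(Aⱼ)_{dⱼ}(2πi q) ≠ 0`, with the same localisation.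
[cite: MantovaMasser2023, §1 p.5 (the open case dim π(V) = 2 in ℂ³×ℂˣ³)] -/
theorem exists_expPoint_of_re_leadingForm_neg {s : ℕ} (g : MvPolynomial (Fin s) ℂ)
    (hD : 0 < g.totalDegree) (q : Fin s → ℤ)
    (hq : (eval (fun j => 2 * Real.pi * I * (q j : ℂ))
      (homogeneousComponent g.totalDegree g)).re < 0)
    (A : Fin s → MvPolynomial (Fin s) ℂ)
    (hA : ∀ j, eval (fun i => 2 * Real.pi * I * (q i : ℂ))
      (homogeneousComponent (A j).totalDegree (A j)) ≠ 0)
    (F : Fin s → MvPolynomial (Fin (s + 1)) ℂ) :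
    ∀ᶠ m : ℕ in atTop, ∃ x : Fin s → ℂ,
      ‖x - fun i => (m : ℂ) * (2 * Real.pi * I * (q i : ℂ)) +
          log (eval (fun k => (m : ℂ) * (2 * Real.pi * I * (q k : ℂ))) (A i))‖ ≤ 1 / 2 ∧
      ∀ j, exp (x j) = eval x (A j) +
        exp (eval x g) * eval (Fin.cons (exp (eval x g)) x) (F j) := by
  classical
  refine exists_expPoint_of_superlog_decay g q A hA F fun N => ?_
  set v : Fin s → ℂ := fun j => 2 * Real.pi * I * (q j : ℂ) with hv
  set D := g.totalDegree with hDdef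
  set c₀ : ℝ := -(eval v (homogeneousComponent D g)).re with hc₀
  have hc₀pos : 0 < c₀ := by rw [hc₀]; linarith
  obtain ⟨ρ, hρ, t₀, ht₀, hnear⟩ := eval_near_natMul_add g v (half_pos hc₀pos)
  filter_upwards [eventually_norm_log_latticeValue_le A v hA hρ,
    tendsto_natCast_atTop_atTop.eventually_ge_atTop t₀,
    eventually_mul_log_add_le (N : ℝ) 0 (half_pos hc₀pos)] with m hmℓ hmt hmN
  intro ξ hξ
  have hm1 : (1 : ℝ) ≤ m := ht₀.trans hmt
  set η : Fin s → ℂ := (fun i => log (eval (fun k => (m : ℂ) * v k) (A i))) + ξ with hη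
  have hsplit : (fun i => (m : ℂ) * v i + log (eval (fun k => (m : ℂ) * v k) (A i))) + ξ =
      (fun i => (m : ℂ) * v i) + η := by
    funext i; simp only [hη, Pi.add_apply]; ring
  have hηρ : ‖η‖ ≤ ρ * m := by
    refine (norm_add_le _ _).trans ?_
    linarith
  have hg := hnear m hmt η hηρ
  rw [hsplit]
  have h1 : (eval ((fun i => (m : ℂ) * v i) + η) g - (m : ℂ) ^ D * eval v (homogeneousComponent D g)).re
      ≤ c₀ / 2 * (m : ℝ) ^ D := (Complex.re_le_norm _).trans hg
  have h2 : ((m : ℂ) ^ D * eval v (homogeneousComponent D g)).re = -(c₀ * (m : ℝ) ^ D) := by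
    have : (m : ℂ) ^ D = (((m : ℝ) ^ D : ℝ) : ℂ) := by push_cast; rfl
    rw [this, Complex.re_ofReal_mul, hc₀]; ring
  rw [Complex.sub_re, h2] at h1
  have h3 : (m : ℝ) ≤ (m : ℝ) ^ D := le_self_pow₀ hm1 hD.ne'
  rw [add_zero] at hmN
  nlinarith

end Summit.Schanuel.Schanuel.Theorems
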